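import Literature.NumberTheory.Automorphic.Liu2021.AppendixC.HeckeTranslates
import HarnessLib

/-!
# The level `K ∩ tKt⁻¹` of the Hecke correspondence `T(t) = [K t K]` as a sufficiently small level
# ([Milne2005ShimuraVarieties] §5 p. 58 «`K′ = K ∩ gKg⁻¹`»; [Liu2021] §4.2)

Topic `NumberTheory/Automorphic`; namespace `Literature.NumberTheory.Automorphic.Liu2021.AppendixC.C5.SmallLevel`.  Theorems only; NO
definition, no named fact, no instance, no notation, no `sorry`.  Cell `hodgecm-mathlib` (D-0151), FLOOR 0, programme F0P5a (D9op road 2′,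
crux item stmt-HodgeConjecture-24832), row PEN-K1 of PLAN v3 (F0P5a-plan (g3)): the MOD letter `RecordCurveCongruenceCorrespondenceCofinal`,
the reindexing letter `HeckeSumReindexing` and the pen `stub_C3_of` of the ED. 5 desk of `Cruxes/HLiu418/Lines/F0_D9opRoad2.lean` all
quantify over a sufficiently small level `K₁ ≤ K` WITH PRESCRIBED CARRIER `K₁ = K ⊓ tKt⁻¹` (`∀ K₁ (hle : K₁ ≤ K) (ht : HeckeLE t K₁ K)
(_hK₁ : K₁.1.1 = K.1.1 ⊓ (K.1.1).map (MulAut.conj t).toMonoidHom)`), so somebody must CONSTRUCT that level inside the index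
`C5.SmallLevel K₀` of [Liu2021] Prop. C.5 — this file does, next to the tree's ★ `heckeLevel t K = tKt⁻¹ ∩ K₀` (`AppendixC/HeckeTranslates`)
and ★ `exists_le_le` ∕ `exists_normal_le` (`AppendixC/RestOneLevelInvariants`):

* `exists_le_val_eq_inf_map_conj K t` — there is `K₁ : SmallLevel K₀` with `K₁ ≤ K` and underlying subgroup EXACTLY
  `K.1.1 ⊓ (K.1.1).map (MulAut.conj t).toMonoidHom` (open: conjugation is a homeomorphism of the topological group; compact: an open subgroup
  is closed, intersected with the compact `K`; the `⊓ K₀` of `heckeLevel` is absorbed by `K ≤ K₀`);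
* `exists_le_le_heckeLevel_val_eq K t` — the same level also lies below `heckeLevel t K`, hence carries `HeckeLE t K₁ K` (★ `heckeLE_heckeLevel`,
  ★ `HeckeLE.of_le_left`): it is an admissible SOURCE of the Hecke translate `T_t : X_{K₁} → X_K` and of the transition `u : X_{K₁} → X_K` at once —
  the two projections of the Hecke correspondence `T(t)` ([Milne2005ShimuraVarieties] §5 p. 58 L6–11).

HC_CM is proved only modulo the 7 printed citations until rung 0 closes; this file is a generic leaf and changes no count.

## References
* [Milne2005ShimuraVarieties] J. S. Milne, *Introduction to Shimura varieties*, Clay Math. Proc. 4 (2005), §5 p. 58 L6–11 (the Hecke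
  correspondence `T(g)` through the level `K ∩ gKg⁻¹`), §13 p. 118 L21–26.
* [Liu2021] Y. Liu, *Fourier–Jacobi cycles and arithmetic relative trace formula*, Camb. J. Math. 9 (2021), §4.2 (FJcycle.tex l. 2060–2074:
  sufficiently small levels and Hecke translates), Prop. C.5 (l. 4627–4628).
-/

set_option autoImplicit false

namespace Literature.NumberTheory.Automorphic.Liu2021.AppendixC

namespace C5.SmallLevel

variable {H : Type} [Group H] [TopologicalSpace H] {K₀ : OpenCompactSubgroup H}

/-! ### §1 The prescribed carrier `K ∩ tKt⁻¹`: membership, `K₁ ≤ K`, `HeckeLE t K₁ K` -/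

/-- Membership in the level `K ∩ tKt⁻¹`, unfolded: `k ∈ K₁ ↔ k ∈ K ∧ t⁻¹ k t ∈ K` (for any `K₁` with the prescribed carrier).
[cite: Milne2005ShimuraVarieties, §5 p. 58 L6–11] -/
theorem mem_iff_of_val_eq_inf_map_conj {K K₁ : SmallLevel K₀} {t : H}
    (hK₁ : (K₁.1.1 : Subgroup H) = K.1.1 ⊓ (K.1.1).map (MulAut.conj t).toMonoidHom) (k : H) :
    k ∈ (K₁.1.1 : Subgroup H) ↔ k ∈ (K.1.1 : Subgroup H) ∧ t⁻¹ * k * t ∈ (K.1.1 : Subgroup H) := by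
  rw [hK₁, Subgroup.mem_inf, and_congr_right_iff]
  intro _
  constructor
  · rintro ⟨x, hx, rfl⟩
    have e : t⁻¹ * ((MulAut.conj t).toMonoidHom x) * t = x := by
      rw [MulEquiv.coe_toMonoidHom, MulAut.conj_apply]
      group
    rw [e]
    exact hx
  · intro hk
    refine ⟨t⁻¹ * k * t, hk, ?_⟩
    rw [MulEquiv.coe_toMonoidHom, MulAut.conj_apply]
    group

/-- For any `K₁` with the prescribed carrier `K ∩ tKt⁻¹`: `K₁ ≤ K` and `HeckeLE t K₁ K` (both projections of `T(t)` are defined on it).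
[cite: Milne2005ShimuraVarieties, §5 p. 58 L6–11] -/
theorem le_and_heckeLE_of_val_eq_inf_map_conj {K K₁ : SmallLevel K₀} {t : H}
    (hK₁ : (K₁.1.1 : Subgroup H) = K.1.1 ⊓ (K.1.1).map (MulAut.conj t).toMonoidHom) :
    K₁ ≤ K ∧ HeckeLE t K₁ K :=
  ⟨fun k hk => ((mem_iff_of_val_eq_inf_map_conj hK₁ k).1 hk).1,
    fun k hk => ((mem_iff_of_val_eq_inf_map_conj hK₁ k).1 hk).2⟩

/-! ### §2 Existence of the level `K ∩ tKt⁻¹` in the index `C5.SmallLevel K₀` -/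

section Topological

variable [IsTopologicalGroup H]

/-- The conjugate `tKt⁻¹` of an open level is open (conjugation by `t` is a homeomorphism of the topological group `H`).
[cite: Milne2005ShimuraVarieties, §5 p. 58 L6–11] -/
theorem isOpen_map_conj (K : SmallLevel K₀) (t : H) :
    IsOpen (((K.1.1).map (MulAut.conj t).toMonoidHom : Subgroup H) : Set H) := by
  have himg : (((K.1.1).map (MulAut.conj t).toMonoidHom : Subgroup H) : Set H) = (fun x : H => t * x * t⁻¹) '' (K.1.1 : Set H) := by
    rw [Subgroup.coe_map]
    rfl
  rw [himg, ← Set.image_image (fun x : H => x * t⁻¹) (fun x : H => t * x)]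
  exact (isOpenMap_mul_right t⁻¹) _ ((isOpenMap_mul_left t) _ K.1.2.1)

/-- **The level `K ∩ tKt⁻¹` is a sufficiently small level below `K`**: for a sufficiently small open compact `K ⊆ K₀` and any `t ∈ H`
there is `K₁ ⊆ K` in the index `C5.SmallLevel K₀` with underlying subgroup EXACTLY `K ⊓ tKt⁻¹` (open by `isOpen_map_conj`; compact as the
intersection of the compact `K` with a closed — because open — subgroup) — the source level `K′ = K ∩ gKg⁻¹` of the Hecke correspondence
`T(g)`. [cite: Milne2005ShimuraVarieties, §5 p. 58 L6–11] [cite: Liu2021, §4.2 FJcycle.tex l. 2060–2074] -/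
theorem exists_le_val_eq_inf_map_conj (K : SmallLevel K₀) (t : H) :
    ∃ K₁ : SmallLevel K₀, K₁ ≤ K ∧ (K₁.1.1 : Subgroup H) = K.1.1 ⊓ (K.1.1).map (MulAut.conj t).toMonoidHom := by
  have hopen := isOpen_map_conj K t
  refine ⟨⟨⟨K.1.1 ⊓ (K.1.1).map (MulAut.conj t).toMonoidHom, ?_, ?_⟩,
      le_trans (inf_le_left : K.1.1 ⊓ (K.1.1).map (MulAut.conj t).toMonoidHom ≤ K.1.1) K.2⟩,
    (inf_le_left : K.1.1 ⊓ (K.1.1).map (MulAut.conj t).toMonoidHom ≤ K.1.1), rfl⟩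
  · simpa only [Subgroup.coe_inf] using K.1.2.1.inter hopen
  · simpa only [Subgroup.coe_inf] using K.1.2.2.inter_right (Subgroup.isClosed_of_isOpen _ hopen)

/-- **`K ∩ tKt⁻¹` is an admissible source for BOTH projections of `T(t)`**: the level of `exists_le_val_eq_inf_map_conj` lies below `K`
(transition `u : X_{K₁} → X_K`) and below the tree's conjugate level `heckeLevel t K = tKt⁻¹ ∩ K₀` (★ `heckeLevel_val`), hence satisfies
`HeckeLE t K₁ K` (★ `heckeLE_heckeLevel`, ★ `HeckeLE.of_le_left`: the Hecke translate `T_t : X_{K₁} → X_K` is defined) — with the carrier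
equation kept for consumers that quantify `∀ K₁, K₁.1.1 = K.1.1 ⊓ (K.1.1).map (MulAut.conj t).toMonoidHom → …`.
[cite: Milne2005ShimuraVarieties, §5 p. 58 L6–11 and §13 p. 118 L21–26] [cite: Liu2021, §4.2 FJcycle.tex l. 2060–2074] -/
theorem exists_le_le_heckeLevel_val_eq (K : SmallLevel K₀) (t : H) :
    ∃ K₁ : SmallLevel K₀, K₁ ≤ K ∧ K₁ ≤ heckeLevel t K ∧ HeckeLE t K₁ K ∧
      (K₁.1.1 : Subgroup H) = K.1.1 ⊓ (K.1.1).map (MulAut.conj t).toMonoidHom := by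
  obtain ⟨K₁, hK₁K, hval⟩ := exists_le_val_eq_inf_map_conj K t
  have hle : K₁ ≤ heckeLevel t K := by
    change K₁.1.1 ≤ (heckeLevel t K).1.1
    rw [heckeLevel_val, hval]
    exact le_inf inf_le_right (le_trans inf_le_left K.2)
  exact ⟨K₁, hK₁K, hle, (heckeLE_heckeLevel t K).of_le_left hle, hval⟩

end Topological

end C5.SmallLevel

end Literature.NumberTheory.Automorphic.Liu2021.AppendixC
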